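import Literature.MathematicalPhysics.QuantumFieldTheory.Balaban1983to89.B5Hk163Decay
import Literature.MathematicalPhysics.QuantumFieldTheory.Balaban1983to89.B6BondElimination

/-!
# Port piece U8 — THE METHOD OF IMAGES, DEFINITIONS: the INFINITE-LATTICE response kernel `𝓚` of [B5] (1.63) read at an integer fine position, and its
# three STENCIL KERNELS (first difference, Laplacian, curl) — the volume-independent objects whose periodisations are the whole-torus window response
# and its token stencils (PORT-PLAN-v4 §2)

Cell `ym-nodeO-ideate` ∕ `ym-balaban-port`, porter `ymgap-nodeO-port-PTB-1` (gen 5).  JOIN-side helper definitions for **stmt-QuantumFields-27238** (K0ᴬ), `--supports … --as helper`.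
[B5] = [Balaban1984PropagatorsI].

THE OBJECTS (all `[folklore]` bookkeeping over the tree's (1.63) symbol `B5Hk163Decay.G163` and the lattice Fourier kernel `B4ContourShift.latticeKernel`).  A fine position is an
integer vector `r ∈ ℤ^{d+1}` (the fine torus point is its class); its BLOCK is `blk n r = ⌊r∕n⌋` (coordinatewise Euclidean quotient, `n = L^{k+1}` fine sites per block side) and
its OFFSET `off n r = r mod n ∈ {0,…,n−1}^{d+1}` — [B5] (1.18) «x ∈ B^k(y)», `x = n·y + a`.  [B5]'s torus kernel of `H_k` between the block point `n·y′ + a` and the unit point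
`y` is the PERIODISATION of `latticeKernel (G163 n μ λ a) (y′ − y)` (✓`B5Hk163Torus.hker_bpt`∕`gker_toT_eq_torusKernel` + ✓`B4TorusKernel.MultiPeriod.torusKernel_descend_eq`);
the definitions below name that volume-INDEPENDENT lattice kernel as a function of the fine position (`imgKer`), and the three finite-difference stencils of the (‴-LocUniv) token
read on it (`kerDiff`, `kerLap`, `kerCurl`; the value stencil is `imgKer` itself).  No estimate is asserted here.

HONEST FRAMING.  Definitions only; nothing of Bałaban asserted; 27931 CLOSED·IMPLICATION-ONLY·IN TOTO unchanged; K0ᴬ 27238 OPEN; NODE O 0∕1; COUNT 8∕28 · K 1∕4 UNMOVED; finite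
`𝕋⁴_{L^K}` at fixed ε — NOT continuum ∕ OS ∕ Clay; **the Yang–Mills mass gap (Clay) is NOT proved.**  No `sorry`, no `instance`, no `notation`; standard axioms.
-/

noncomputable section

open scoped BigOperators

namespace Summit.QuantumFields.YangMills.Theorems.PortU8.Images

open Literature.MathematicalPhysics.QuantumFieldTheory.Balaban1983to89
open Literature.MathematicalPhysics.QuantumFieldTheory.Balaban1983to89.B4ContourShift (latticeKernel)
open Literature.MathematicalPhysics.QuantumFieldTheory.Balaban1983to89.B5Hk163Decay (G163)
open Literature.MathematicalPhysics.QuantumFieldTheory.Balaban1983to89.B6BondElimination (unitVec)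

variable {d : ℕ}

/-- **The block of an integer fine position**: `blk n r = ⌊r∕n⌋` coordinatewise (Euclidean quotient) — [B5] (1.18) «x ∈ B^k(y)», `x = n·y + a`.
[cite: Balaban1984PropagatorsI, (1.18) p.20] -/
def blk (n : ℕ) (r : Fin (d + 1) → ℤ) : Fin (d + 1) → ℤ := fun i => r i / (n : ℤ)

/-- The offset coordinate `r mod n` is `< n` (`n ≥ 1`). [cite: Balaban1984PropagatorsI, (1.18) p.20] -/
theorem emod_toNat_lt (n : ℕ) [NeZero n] (z : ℤ) : (z % (n : ℤ)).toNat < n := by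
  have hn : (0 : ℤ) < n := by exact_mod_cast Nat.pos_of_ne_zero (NeZero.ne n)
  have h1 : z % (n : ℤ) < n := Int.emod_lt_of_pos z hn
  have h0 : 0 ≤ z % (n : ℤ) := Int.emod_nonneg z hn.ne'
  omega

/-- **The offset of an integer fine position inside its block**: `off n r = r mod n ∈ {0,…,n−1}^{d+1}` — the `a` of `x = n·y + a`. [cite: Balaban1984PropagatorsI, (1.18) p.20] -/
def off (n : ℕ) [NeZero n] (r : Fin (d + 1) → ℤ) : Fin (d + 1) → Fin n := fun i => ⟨(r i % (n : ℤ)).toNat, emod_toNat_lt n (r i)⟩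

/-- **THE INFINITE-LATTICE RESPONSE KERNEL `𝓚_n(μ, λ; r)`**: the `ℤ^{d+1}`-Fourier kernel of [B5]'s (1.63) coarse multiplier `G_a` of the offset `a = off n r`, evaluated at the
block `blk n r` — the kernel whose periodisation over the coarse period lattice is the torus kernel of `H_k` from the unit bond `⟨0, λ⟩` to the fine bond `⟨r, μ⟩`
(✓`B5Hk163Torus.hker_bpt`, ✓`gker_toT_eq_torusKernel`, ✓`B4TorusKernel.MultiPeriod.torusKernel_descend_eq`); it does NOT depend on the volume.
[cite: Balaban1984PropagatorsI, (1.63) p.28, p.36 ll.20–23] -/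
def imgKer (n : ℕ) [NeZero n] (μ lam : Fin (d + 1)) (r : Fin (d + 1) → ℤ) : ℂ :=
  latticeKernel (fun p : Fin (d + 1) → ℂ => G163 n μ lam (off n r) p) (blk n r)

/-- **The first-difference stencil kernel** in the fine direction `ν`: `𝓚(r + e_ν) − 𝓚(r)`. [cite: Balaban1985Variational, (190) p.308 (second line); Balaban1984PropagatorsI, (1.63) p.28] -/
def kerDiff (n : ℕ) [NeZero n] (μ lam ν : Fin (d + 1)) (r : Fin (d + 1) → ℤ) : ℂ :=
  imgKer n μ lam (r + unitVec ν) - imgKer n μ lam r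

/-- **The Laplacian stencil kernel**: `Σ_ν [𝓚(r + e_ν) − 2𝓚(r) + 𝓚(r − e_ν)]`. [cite: Balaban1985Variational, (190) p.308 (third line); Balaban1984PropagatorsI, (1.21) p.21] -/
def kerLap (n : ℕ) [NeZero n] (μ lam : Fin (d + 1)) (r : Fin (d + 1) → ℤ) : ℂ :=
  ∑ ν : Fin (d + 1), (imgKer n μ lam (r + unitVec ν) - 2 * imgKer n μ lam r + imgKer n μ lam (r - unitVec ν))

/-- **The curl (`∂*∂`) stencil kernel** at the fine bond `⟨r, μ⟩`: `Σ_ν [C_{μν}(r) − C_{μν}(r − e_ν)]`, `C_{μν}(r) = 𝓚_μ(r) + 𝓚_ν(r + e_μ) − 𝓚_μ(r + e_ν) − 𝓚_ν(r)` (the token's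
plaquette stencil, directions as kernel indices). [cite: Balaban1985Variational, (190) p.308 (fourth line), (137) p.298; Balaban1985RegularSpaces, (1.2) p.76] -/
def kerCurl (n : ℕ) [NeZero n] (μ lam : Fin (d + 1)) (r : Fin (d + 1) → ℤ) : ℂ :=
  ∑ ν : Fin (d + 1),
    ((imgKer n μ lam r + imgKer n ν lam (r + unitVec μ) - imgKer n μ lam (r + unitVec ν) - imgKer n ν lam r) -
      (imgKer n μ lam (r - unitVec ν) + imgKer n ν lam (r - unitVec ν + unitVec μ) - imgKer n μ lam (r - unitVec ν + unitVec ν) -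
        imgKer n ν lam (r - unitVec ν)))

end Summit.QuantumFields.YangMills.Theorems.PortU8.Images

end
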